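import Literature.IUT.LogVolume.Corollary22FullGaloisImage
import Literature.IUT.LogVolume.Corollary22PartIIPointwise
import Literature.IUT.LogVolume.Corollary22HypothesesWitness
import Literature.NumberTheory.DiophantineGeometry.AbcWave0UniformABCProofs
import HarnessLib

/-!
# [IUTchIV] Cor. 2.2 (ii): the antecedent of the Theorem-1.10 interface `Cor22.Thm110Legendre` is
# SATISFIABLE at points of unbounded `log(q^∀)` — a non-vacuity witness for the S chain's disputed input

S. Mochizuki, *Inter-universal Teichmüller theory IV*, RIMS manuscript (Apr. 2020) = PRIMS **57** (2021),
Cor. 2.2 (ii), statement pp. 41–43, proof pp. 43–48 ((P1)–(P7) pp. 45–46) [claim: Mochizuki2012, status: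
disputed] (claim key, D-0012; the content of THIS file is classical arithmetic of the `λ`-line); S. Mochizuki,
*Arithmetic elliptic curves in general position*, Math. J. Okayama Univ. **52** (2010), Ex. 1.3 (ii) p. 5
[cite: MochizukiGenEll2010, Ex 1.3 (ii) p.5].

Proof-only companion (cell abc-iut, layer S, seat abc-iut-S-d3; node IUTchIV:Cor2.2(ii), support /
non-vacuity). The campaign-S chain `Cor. 3.12 ⟹ Thm 1.10 ⟹ Cor. 2.2 ⟹ Cor. 2.3 ⟹ abc` is closed in the tree
modulo the ONE named interface `Cor22.Thm110Legendre` (`Corollary22Legendre.lean`, abc-iut-S-d2):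
`∀ η, IsEtaPrm η → ∀ P ∈ UP, ∀ l prime ≥ 5, AdmitsCore P → CondP2 P l → CondP5 P l → CondP6 P l → Display P l η`.
A `∀`-statement with unsatisfiable antecedents would be trivially true; this file shows IN THE KERNEL that they
are JOINTLY SATISFIABLE, at `λ`-line points of arbitrarily large `log(q^∀)` in the standard compactly bounded
subset `K_V = CBData.std {2}` (abc-iut-S4; hypotheses of Cor. 2.2 by abc-iut-w5-d056 `Cor22.hypotheses_std`):

* `Cor22.exists_ratPoint_mem_std_two` — for every `H` a rational `λ` with `ratPoint λ ∈ K_V ∩ U_X(ℚ̄)^{≤1}`,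
  `AdmitsCore`, a pole of `j(λ)` at `7`, `H < log(q^∀(λ))` (family `λ_k = 1/2 + 2/7^k`: `|λ_k − 1/2| ≤ 1/4`,
  `‖λ_k − 1/2‖₂ = ‖2‖₂`, `ord_7 j(λ_k) = −2k`); so the "off `Exc_d`" branch of `Cor22.PartII K_V H` is NOT vacuous;
* `Cor22.condP2_of_lt` — GENERAL: `h_v·log 2 ≤ [F:ℚ]·log(q^∀)` for every local height, so any prime
  `l > [F:ℚ]·log(q^∀)/log 2` satisfies (P2) ("`l` does not divide any nonzero `h_v`", p. 45);
* `Cor22.exists_thm110Legendre_antecedent` — ∀ `H` ∃ `η, P, l`: `IsEtaPrm η` (abc-iut-S3 `exists_isEtaPrm`),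
  `P ∈ UP ∩ K_V`, `l` prime `≥ 7`, `AdmitsCore P`, `CondP2/CondP5/CondP6 P l` (the last by abc-iut-S-d1's PROVED
  (P4) ⟹ (P6) `Cor22.condP6_of_seven_le`), `H < log(q^∀(P))`; `Cor22.exists_display_of_thm110Legendre` — hence
  `Thm110Legendre` FORCES the display of [IUTchIV] Thm. 1.10 (`Cor22.Display`) at points of unbounded `log(q^∀)`.

No definitions, no new named fact; nothing here bears on the disputed [IUTchIII] Cor. 3.12 or asserts
`Thm110Legendre`, `Display`, or any clause of Cor. 2.2 itself; typed ≠ proved.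
-/

noncomputable section

namespace Literature.IUT.LogVolume

namespace Cor22

open NumberField IsDedekindDomain Metric
open Literature.NumberTheory.DiophantineGeometry Literature.NumberTheory.DiophantineGeometry.GenEll

/-- For every prime `p` there is a finite place of `ℚ` over it (Mathlib `Rat.HeightOneSpectrum.primesEquiv`).
[folklore] -/
private theorem exists_place_natGenerator_eq {p : ℕ} (hp : p.Prime) :
    ∃ v : HeightOneSpectrum (𝓞 ℚ), Rat.HeightOneSpectrum.natGenerator v = p :=
  ⟨(Rat.HeightOneSpectrum.primesEquiv (R := 𝓞 ℚ)).symm ⟨p, hp⟩,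
    congrArg Subtype.val ((Rat.HeightOneSpectrum.primesEquiv (R := 𝓞 ℚ)).apply_symm_apply ⟨p, hp⟩)⟩

/-- A natural number prime to the prime under `v` has `ord_v = 0`. [folklore] -/
private theorem ord_natCast_eq_zero_of_not_dvd (v : HeightOneSpectrum (𝓞 ℚ)) {n : ℕ}
    (h : ¬ Rat.HeightOneSpectrum.natGenerator v ∣ n) : ord ℚ v (n : ℚ) = 0 := by
  unfold ord
  rw [(UniformABCConjecture.valuation_natCast_eq_one_iff v n).2 h, WithZero.log_one, neg_zero]

/-- Natural numbers have `ord_v ≥ 0`. [folklore] -/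
private theorem ord_natCast_nonneg (v : HeightOneSpectrum (𝓞 ℚ)) (n : ℕ) : 0 ≤ ord ℚ v (n : ℚ) := by
  simpa using ord_nonneg_of_isIntegral ℚ v (n : 𝓞 ℚ)

/-- The prime `p_v` under `v` has `ord_v(p_v) ≥ 1`. [folklore] -/
private theorem one_le_ord_natGenerator (v : HeightOneSpectrum (𝓞 ℚ)) :
    1 ≤ ord ℚ v (Rat.HeightOneSpectrum.natGenerator v : ℚ) := by
  have hp : (Rat.HeightOneSpectrum.natGenerator v : 𝓞 ℚ) ≠ 0 := by
    exact_mod_cast (Rat.HeightOneSpectrum.prime_natGenerator v).ne_zero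
  have hmem : (Rat.HeightOneSpectrum.natGenerator v : 𝓞 ℚ) ∈ v.asIdeal :=
    (UniformABCConjecture.natCast_mem_asIdeal_iff v _).2 dvd_rfl
  have h : 0 < ord ℚ v (Rat.HeightOneSpectrum.natGenerator v : ℚ) := by
    simpa using (ord_pos_iff_mem ℚ v _ hp).2 hmem
  omega

/-- A quotient of natural numbers with denominator prime to `p_v` has `ord_v ≥ 0`. [folklore] -/
private theorem ord_natCast_div_nonneg (v : HeightOneSpectrum (𝓞 ℚ)) (a : ℕ) {b : ℕ}
    (hb : ¬ Rat.HeightOneSpectrum.natGenerator v ∣ b) : 0 ≤ ord ℚ v ((a : ℚ) / b) := by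
  by_cases ha : a = 0
  · rw [ha, Nat.cast_zero, zero_div, ord_zero]
  have hb0 : b ≠ 0 := by rintro rfl; exact hb (dvd_zero _)
  rw [div_eq_mul_inv, ord_mul ℚ v (by exact_mod_cast ha) (inv_ne_zero (by exact_mod_cast hb0)), ord_inv,
    ord_natCast_eq_zero_of_not_dvd v hb, neg_zero, add_zero]
  exact ord_natCast_nonneg v a

/-- `ln|κ(v)| = log p_v` for a finite place `v` of `ℚ`. [folklore] -/
private theorem logNorm_rat_eq (v : HeightOneSpectrum (𝓞 ℚ)) :
    logNorm ℚ v = Real.log (Rat.HeightOneSpectrum.natGenerator v) := by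
  rw [logNorm, UniformABCConjecture.absNorm_asIdeal_eq_natGenerator]

/-- `7 ∤ 7^k + 4` (`k ≥ 1`). [folklore] -/
private theorem not_seven_dvd_pow_add_four {k : ℕ} (hk : 1 ≤ k) : ¬ 7 ∣ 7 ^ k + 4 := fun h => by
  have : 7 ∣ 4 := (Nat.dvd_add_right (dvd_pow_self 7 (by omega : k ≠ 0))).1 h
  omega

/-- `7 ∤ 7^k − 4` (`k ≥ 1`). [folklore] -/
private theorem not_seven_dvd_pow_sub_four {k : ℕ} (hk : 1 ≤ k) : ¬ 7 ∣ 7 ^ k - 4 := fun h => by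
  have hle : 7 ≤ 7 ^ k := by simpa using Nat.pow_le_pow_right (by norm_num : 1 ≤ 7) hk
  have : 7 ∣ 7 ^ k - (7 ^ k - 4) := Nat.dvd_sub (dvd_pow_self 7 (by omega : k ≠ 0)) h
  rw [Nat.sub_sub_self (by omega : 4 ≤ 7 ^ k)] at this
  omega

/-- `7 ∤ 3·7^(2k) + 16` (`k ≥ 1`). [folklore] -/
private theorem not_seven_dvd_three_mul_pow_add {k : ℕ} (hk : 1 ≤ k) :
    ¬ 7 ∣ 3 * 7 ^ (2 * k) + 16 := fun h => by
  have : 7 ∣ 16 := (Nat.dvd_add_right ((dvd_pow_self 7 (by omega : 2 * k ≠ 0)).mul_left 3)).1 h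
  omega

/-- `j(λ_k) = 2^6·(3·7^{2k} + 16)^3 / ((7^k + 4)^2·(7^k − 4)^2·7^{2k})` for `λ_k = 1/2 + 2/7^k`. [folklore] -/
private theorem jInv_lam_eq {k : ℕ} (hk : 1 ≤ k) :
    jInv ((2 : ℚ)⁻¹ + 2 / 7 ^ k) =
      ((64 * (3 * 7 ^ (2 * k) + 16) ^ 3 : ℕ) : ℚ) /
        ((((7 ^ k + 4) ^ 2 * (7 ^ k - 4) ^ 2 : ℕ) : ℚ) * (7 : ℚ) ^ (2 * k)) := by
  have hle : 7 ≤ 7 ^ k := by simpa using Nat.pow_le_pow_right (by norm_num : 1 ≤ 7) hk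
  have hx : (7 : ℚ) ^ k ≠ 0 := pow_ne_zero _ (by norm_num)
  have h4 : (7 : ℚ) ^ k - 4 ≠ 0 := by
    have : ((7 ^ k : ℕ) : ℚ) - 4 ≠ 0 := by
      have h' : (7 : ℚ) ≤ ((7 ^ k : ℕ) : ℚ) := by exact_mod_cast hle
      intro h0; linarith
    simpa using this
  have h5 : (7 : ℚ) ^ k + 4 ≠ 0 := by positivity
  have hn1 : ((64 * (3 * 7 ^ (2 * k) + 16) ^ 3 : ℕ) : ℚ) = 64 * (3 * (7 : ℚ) ^ (2 * k) + 16) ^ 3 := by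
    push_cast; ring
  have hn2 : (((7 ^ k + 4) ^ 2 * (7 ^ k - 4) ^ 2 : ℕ) : ℚ) = ((7 : ℚ) ^ k + 4) ^ 2 * ((7 : ℚ) ^ k - 4) ^ 2 := by
    rw [Nat.cast_mul, Nat.cast_pow, Nat.cast_pow, Nat.cast_sub (by omega : 4 ≤ 7 ^ k)]
    push_cast; ring
  have hA : ((2 : ℚ)⁻¹ + 2 / 7 ^ k) ^ 2 - ((2 : ℚ)⁻¹ + 2 / 7 ^ k) + 1 =
      (3 * 7 ^ (2 * k) + 16) / (4 * 7 ^ (2 * k)) := by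
    field_simp; ring
  have hB : ((2 : ℚ)⁻¹ + 2 / 7 ^ k) ^ 2 * (((2 : ℚ)⁻¹ + 2 / 7 ^ k) - 1) ^ 2 =
      (7 ^ k + 4) ^ 2 * (7 ^ k - 4) ^ 2 / (16 * 7 ^ (4 * k)) := by
    field_simp; ring
  rw [hn1, hn2]
  unfold jInv
  rw [hA, hB]
  field_simp
  ring

/-- **`ord_v j(λ_k) = −2k·ord_v(7)`** at the place `v` of `ℚ` over `7` (`k ≥ 1`). [folklore] -/
private theorem ord_jInv_lam (v : HeightOneSpectrum (𝓞 ℚ)) (hv : Rat.HeightOneSpectrum.natGenerator v = 7)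
    {k : ℕ} (hk : 1 ≤ k) :
    ord ℚ v (jInv ((2 : ℚ)⁻¹ + 2 / 7 ^ k)) = -(2 * k * ord ℚ v (7 : ℚ)) := by
  have h7p : Nat.Prime 7 := by norm_num
  have hle : 7 ≤ 7 ^ k := by simpa using Nat.pow_le_pow_right (by norm_num : 1 ≤ 7) hk
  have hA : ¬ Rat.HeightOneSpectrum.natGenerator v ∣ 64 * (3 * 7 ^ (2 * k) + 16) ^ 3 := by
    rw [hv]; intro h
    rcases (Nat.Prime.dvd_mul h7p).1 h with h | h
    · omega
    · exact not_seven_dvd_three_mul_pow_add hk (Nat.Prime.dvd_of_dvd_pow h7p h)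
  have hB : ¬ Rat.HeightOneSpectrum.natGenerator v ∣ (7 ^ k + 4) ^ 2 * (7 ^ k - 4) ^ 2 := by
    rw [hv]; intro h
    rcases (Nat.Prime.dvd_mul h7p).1 h with h | h
    · exact not_seven_dvd_pow_add_four hk (Nat.Prime.dvd_of_dvd_pow h7p h)
    · exact not_seven_dvd_pow_sub_four hk (Nat.Prime.dvd_of_dvd_pow h7p h)
  have hA0 : ((64 * (3 * 7 ^ (2 * k) + 16) ^ 3 : ℕ) : ℚ) ≠ 0 := by positivity
  have hB0 : (((7 ^ k + 4) ^ 2 * (7 ^ k - 4) ^ 2 : ℕ) : ℚ) ≠ 0 := by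
    have : (7 ^ k + 4) ^ 2 * (7 ^ k - 4) ^ 2 ≠ 0 :=
      mul_ne_zero (pow_ne_zero _ (by omega)) (pow_ne_zero _ (by omega))
    exact_mod_cast this
  have h70 : (7 : ℚ) ^ (2 * k) ≠ 0 := pow_ne_zero _ (by norm_num)
  rw [jInv_lam_eq hk, div_eq_mul_inv, ord_mul ℚ v hA0 (inv_ne_zero (mul_ne_zero hB0 h70)), ord_inv,
    ord_mul ℚ v hB0 h70, ord_pow, ord_natCast_eq_zero_of_not_dvd v hA, ord_natCast_eq_zero_of_not_dvd v hB]
  push_cast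
  ring

/-- `ord_v j(λ_k) < 0` at the place over `7` (`k ≥ 1`): a pole of `j`. [folklore] -/
private theorem ord_jInv_lam_neg (v : HeightOneSpectrum (𝓞 ℚ)) (hv : Rat.HeightOneSpectrum.natGenerator v = 7)
    {k : ℕ} (hk : 1 ≤ k) : ord ℚ v (jInv ((2 : ℚ)⁻¹ + 2 / 7 ^ k)) < 0 := by
  rw [ord_jInv_lam v hv hk]
  have ht : 1 ≤ ord ℚ v (7 : ℚ) := by have := one_le_ord_natGenerator v; rwa [hv] at this
  have : (1 : ℤ) ≤ k := by exact_mod_cast hk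
  nlinarith

/-- `λ_k = 1/2 + 2/7^k ≠ 0, 1` (`k ≥ 1`). [folklore] -/
private theorem lam_ne {k : ℕ} (hk : 1 ≤ k) :
    ((2 : ℚ)⁻¹ + 2 / 7 ^ k) ≠ 0 ∧ ((2 : ℚ)⁻¹ + 2 / 7 ^ k) ≠ 1 := by
  have h1 : (0 : ℚ) < 2 / 7 ^ k := by positivity
  have h7k : (7 : ℚ) ≤ 7 ^ k := by exact_mod_cast Nat.le_self_pow (by omega : k ≠ 0) 7
  have h2 : (2 : ℚ) / 7 ^ k ≤ 2 / 7 := div_le_div_of_nonneg_left (by norm_num) (by norm_num) h7k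
  constructor <;> intro h <;> linarith

/-- One bad place bounds `log(q^∀)` from below: `h_v·ln|κ(v)| ≤ [F:ℚ]·log(q^∀(P))`.
[claim: Mochizuki2012, status: disputed] -/
theorem localHeight_mul_logNorm_le (P : NFPoint) {v : HeightOneSpectrum (𝓞 P.F)} (hv : v ∈ badPlaces P) :
    localHeight P v * logNorm P.F v ≤ (P.degree : ℝ) * logQForall P := by
  classical
  have h := degree_mul_logQAvoid P ∅
  rw [Finset.filter_true_of_mem (fun v _ => by simp)] at h
  unfold logQForall
  rw [h]
  exact Finset.single_le_sum (f := fun w => localHeight P w * logNorm P.F w)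
    (fun w _ => mul_nonneg (localHeight_nonneg P w) (logNorm_pos P.F w).le) hv

/-- Every local height satisfies `h_v·log 2 ≤ [F:ℚ]·log(q^∀(P))` (`|κ(v)| ≥ 2`).
[claim: Mochizuki2012, status: disputed] -/
theorem localHeight_mul_log_two_le (P : NFPoint) (v : HeightOneSpectrum (𝓞 P.F)) :
    localHeight P v * Real.log 2 ≤ (P.degree : ℝ) * logQForall P := by
  classical
  by_cases hv : v ∈ badPlaces P
  · refine le_trans ?_ (localHeight_mul_logNorm_le P hv)
    apply mul_le_mul_of_nonneg_left _ (localHeight_nonneg P v)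
    unfold logNorm
    exact Real.log_le_log (by norm_num) (by exact_mod_cast NumberField.HeightOneSpectrum.one_lt_absNorm v)
  · have h0 : localHeight P v = 0 := by
      have h' : ¬ ord P.F v (jInv P.x) < 0 := fun h => hv ((mem_badPlaces_iff_ord_neg P v).2 h)
      unfold localHeight
      rw [Int.toNat_of_nonpos (by omega), Nat.cast_zero]
    rw [h0, zero_mul]
    exact mul_nonneg (Nat.cast_nonneg _) (logQAvoid_nonneg P ∅)

/-- **(P2) from a size bound**: if `[F:ℚ]·log(q^∀(P))/log 2 < l` then `l` divides no (negative) `ord_v j`,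
since a bad place has `0 < h_v = −ord_v j ≤ [F:ℚ]·log(q^∀)/log 2 < l` — i.e. `CondP2 P l` (p. 45 (P2): "`l`
does not divide any nonzero `h_v`"). [claim: Mochizuki2012, status: disputed] -/
theorem condP2_of_lt (P : NFPoint) {l : ℕ} (hl : (P.degree : ℝ) * logQForall P / Real.log 2 < l) :
    CondP2 P l := by
  intro v hv hdvd
  have hlog2 : (0 : ℝ) < Real.log 2 := Real.log_pos (by norm_num)
  have hbad : v ∈ badPlaces P := (mem_badPlaces_iff_ord_neg P v).2 hv
  have hh := localHeight_mul_log_two_le P v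
  rw [localHeight_eq_neg_ord hbad] at hh
  obtain ⟨c, hc⟩ := hdvd
  have hl0 : (0 : ℤ) ≤ l := Int.natCast_nonneg l
  have hc' : c ≤ -1 := by
    by_contra h'
    have : (0 : ℤ) ≤ l * c := mul_nonneg hl0 (by omega)
    omega
  have hge : (l : ℤ) ≤ -(ord P.F v (jInv P.x)) := by rw [hc]; nlinarith
  have hge' : (l : ℝ) ≤ -(ord P.F v (jInv P.x) : ℝ) := by exact_mod_cast hge
  have h1 : (l : ℝ) * Real.log 2 ≤ (P.degree : ℝ) * logQForall P :=
    le_trans (mul_le_mul_of_nonneg_right hge' hlog2.le) hh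
  have h2 : (P.degree : ℝ) * logQForall P < l * Real.log 2 := by rwa [div_lt_iff₀ hlog2] at hl
  linarith

/-- A pole of `j` of order `m` at `v` gives `m·ln|κ(v)| ≤ [F:ℚ]·log(q^∀(P))`. [claim: Mochizuki2012, status: disputed] -/
theorem neg_ord_mul_logNorm_le (P : NFPoint) (v : HeightOneSpectrum (𝓞 P.F)) (hv : ord P.F v (jInv P.x) < 0) :
    -(ord P.F v (jInv P.x) : ℝ) * logNorm P.F v ≤ (P.degree : ℝ) * logQForall P := by
  have hbad : v ∈ badPlaces P := (mem_badPlaces_iff_ord_neg P v).2 hv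
  have h := localHeight_mul_logNorm_le P hbad
  rwa [localHeight_eq_neg_ord hbad] at h

/-- **`log(q^∀(λ_k)) ≥ 2k·log 7`** (`k ≥ 1`): the place `7` is bad with local height `2k·ord(7) ≥ 2k`.
[claim: Mochizuki2012, status: disputed] -/
theorem two_mul_log_seven_le_logQForall_lam {k : ℕ} (hk : 1 ≤ k) :
    2 * k * Real.log 7 ≤ logQForall (ratPoint ((2 : ℚ)⁻¹ + 2 / 7 ^ k)) := by
  obtain ⟨v, hv⟩ := exists_place_natGenerator_eq (show Nat.Prime 7 by norm_num)
  have ht : (1 : ℝ) ≤ (ord ℚ v (7 : ℚ) : ℝ) := by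
    have := one_le_ord_natGenerator v
    rw [hv] at this
    exact_mod_cast this
  have h : -((ord ℚ v (jInv ((2 : ℚ)⁻¹ + 2 / 7 ^ k)) : ℤ) : ℝ) * logNorm ℚ v ≤
      ((ratPoint ((2 : ℚ)⁻¹ + 2 / 7 ^ k)).degree : ℝ) * logQForall (ratPoint ((2 : ℚ)⁻¹ + 2 / 7 ^ k)) :=
    neg_ord_mul_logNorm_le (ratPoint ((2 : ℚ)⁻¹ + 2 / 7 ^ k)) v (ord_jInv_lam_neg v hv hk)
  rw [ord_jInv_lam v hv hk, logNorm_rat_eq, hv, degree_ratPoint] at h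
  push_cast at h
  rw [neg_neg, one_mul] at h
  have h0 : (0 : ℝ) ≤ 2 * k * Real.log 7 :=
    mul_nonneg (mul_nonneg (by norm_num) (Nat.cast_nonneg k)) (Real.log_nonneg (by norm_num))
  calc 2 * (k : ℝ) * Real.log 7 = (2 * k * Real.log 7) * 1 := (mul_one _).symm
    _ ≤ (2 * k * Real.log 7) * (ord ℚ v (7 : ℚ) : ℝ) := mul_le_mul_of_nonneg_left ht h0
    _ = 2 * k * (ord ℚ v (7 : ℚ) : ℝ) * Real.log 7 := by ring
    _ ≤ _ := h

/-- `ratPoint λ_k ∈ K_V = CBData.std {2}` for `k ≥ 2`: `|λ_k − 1/2| = 2/7^k ≤ 1/4` and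
`‖λ_k − 1/2‖₂ = ‖2‖₂·‖7‖₂^{−k} = ‖2‖₂`. [cite: MochizukiGenEll2010, Ex 1.3 (ii) p.5] -/
theorem ratPoint_lam_mem_std_two {k : ℕ} (hk : 2 ≤ k) (hS : ∀ p ∈ ({2} : Finset ℕ), p.Prime) :
    ratPoint ((2 : ℚ)⁻¹ + 2 / 7 ^ k) ∈ (CBData.std {2} hS).toSet := by
  refine ⟨fun σ => ?_, fun p hp _ σ => ?_⟩
  · have h1 : σ (ratPoint ((2 : ℚ)⁻¹ + 2 / 7 ^ k)).x = (((2 : ℚ)⁻¹ + 2 / 7 ^ k : ℚ) : ℂ) :=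
      eq_ratCast (σ : ℚ →+* ℂ) _
    change σ (ratPoint ((2 : ℚ)⁻¹ + 2 / 7 ^ k)).x ∈ CBData.stdArc
    rw [h1, CBData.stdArc, mem_closedBall, dist_eq_norm]
    push_cast
    rw [show (2 : ℂ)⁻¹ + 2 / 7 ^ k - 2⁻¹ = 2 / 7 ^ k by ring, norm_div, norm_pow]
    simp only [RCLike.norm_ofNat]
    have h49 : (49 : ℝ) ≤ 7 ^ k := by
      have : ((7 ^ 2 : ℕ) : ℝ) ≤ ((7 ^ k : ℕ) : ℝ) := by exact_mod_cast Nat.pow_le_pow_right (by norm_num) hk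
      push_cast at this; linarith
    rw [div_le_iff₀ (by positivity)]
    linarith
  · have hp2 : p = 2 := by change p ∈ ({2} : Finset ℕ) at hp; simpa using hp
    subst hp2
    have h1 : σ (ratPoint ((2 : ℚ)⁻¹ + 2 / 7 ^ k)).x = (((2 : ℚ)⁻¹ + 2 / 7 ^ k : ℚ) : PadicAlgCl 2) :=
      eq_ratCast (σ : ℚ →+* PadicAlgCl 2) _
    change σ (ratPoint ((2 : ℚ)⁻¹ + 2 / 7 ^ k)).x ∈ CBData.stdNon 2
    rw [h1, CBData.stdNon, mem_closedBall, dist_eq_norm]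
    push_cast
    rw [show (2 : PadicAlgCl 2)⁻¹ + 2 / 7 ^ k - 2⁻¹ = 2 / 7 ^ k by ring, norm_div, norm_pow]
    have h7 : ‖(7 : PadicAlgCl 2)‖ = 1 := by
      have e : (7 : PadicAlgCl 2) = (((7 : ℕ) : ℚ_[2]) : PadicAlgCl 2) := by
        rw [map_natCast]; norm_num
      rw [e, PadicAlgCl.norm_extends, Padic.norm_natCast_eq_one_iff]
      norm_num
    simp only [h7, one_pow, div_one, le_refl]

/-- **`AdmitsCore (ratPoint λ_k)`** (`k ≥ 1`): `j(λ_k)` has a pole at `7`, whereas the four exceptional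
`j`-invariants `2^{14}31^3/5^3, 2^2 73^3/3^4, 1728, 0` (p. 43) are `7`-integral. [claim: Mochizuki2012, status: disputed] -/
theorem admitsCore_ratPoint_lam {k : ℕ} (hk : 1 ≤ k) : AdmitsCore (ratPoint ((2 : ℚ)⁻¹ + 2 / 7 ^ k)) := by
  obtain ⟨v, hv⟩ := exists_place_natGenerator_eq (show Nat.Prime 7 by norm_num)
  have hord := ord_jInv_lam_neg v hv hk
  intro r hr heq
  change jInv ((2 : ℚ)⁻¹ + 2 / 7 ^ k) = r at heq
  have hnonneg : 0 ≤ ord ℚ v r := by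
    simp only [coreExceptionalJ, Finset.mem_insert, Finset.mem_singleton] at hr
    rcases hr with rfl | rfl | rfl | rfl
    · simpa using ord_natCast_div_nonneg v 488095744 (b := 125) (by rw [hv]; norm_num)
    · simpa using ord_natCast_div_nonneg v 1556068 (b := 81) (by rw [hv]; norm_num)
    · simpa using ord_natCast_nonneg v 1728
    · rw [ord_zero]
  rw [heq] at hord
  omega

/-- **Points of `K_V ∩ U_X(ℚ̄)^{≤1}` with arbitrarily large `log(q^∀)`**: for every `H` a rational `λ` with
`ratPoint λ ∈ (CBData.std {2}).toSet ∩ UPle 1`, `AdmitsCore`, a pole of `j(λ)` at the place over `7`, and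
`H < log(q^∀(λ))`. So the large-height branch of `Cor22.PartII (CBData.std {2}) H_II` is over a NONEMPTY set.
[cite: Mochizuki2012, IUTchIV Cor 2.2 (ii) pp.41-42] -/
theorem exists_ratPoint_mem_std_two (hS : ∀ p ∈ ({2} : Finset ℕ), p.Prime) (H : ℝ) :
    ∃ q : ℚ, ratPoint q ∈ (CBData.std {2} hS).toSet ∧ ratPoint q ∈ UPle 1 ∧ AdmitsCore (ratPoint q) ∧
      H < logQForall (ratPoint q) ∧
      ∀ v : HeightOneSpectrum (𝓞 ℚ), Rat.HeightOneSpectrum.natGenerator v = 7 → ord ℚ v (jInv q) < 0 := by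
  obtain ⟨k, hk, hk2⟩ : ∃ k : ℕ, k = ⌈H⌉₊ + 2 ∧ 2 ≤ k := ⟨⌈H⌉₊ + 2, rfl, by omega⟩
  have hk1 : 1 ≤ k := by omega
  refine ⟨(2 : ℚ)⁻¹ + 2 / 7 ^ k, ratPoint_lam_mem_std_two hk2 hS,
    ratPoint_mem_UPle_one (lam_ne hk1).1 (lam_ne hk1).2, admitsCore_ratPoint_lam hk1, ?_,
    fun v hv => ord_jInv_lam_neg v hv hk1⟩
  have h := two_mul_log_seven_le_logQForall_lam hk1
  have h27 : Real.log 2 ≤ Real.log 7 := Real.log_le_log (by norm_num) (by norm_num)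
  have hlog : (1 : ℝ) / 2 < Real.log 7 := by linarith [Real.log_two_gt_d9]
  have hH : H ≤ ⌈H⌉₊ := Nat.le_ceil H
  have hkR : (k : ℝ) = ⌈H⌉₊ + 2 := by rw [hk]; push_cast; ring
  have hk0 : (0 : ℝ) ≤ k := Nat.cast_nonneg k
  have e1 : (k : ℝ) * (1 / 2) ≤ k * Real.log 7 := mul_le_mul_of_nonneg_left hlog.le hk0
  linarith

/-- **NON-VACUITY of the antecedent of `Cor22.Thm110Legendre`, at points of unbounded `log(q^∀)`.** For every
`H` there are `η, P, l` with: `IsEtaPrm η` ([IUTchIV] Prop. 1.6; `exists_isEtaPrm`); `P ∈ UP`, indeed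
`P ∈ K_V ∩ U_X(ℚ̄)^{≤1}` for `K_V = CBData.std {2}`; `l` prime, `7 ≤ l`; `AdmitsCore P`; (P2) `CondP2 P l`
(`l > log(q^∀)/log 2`); (P5) `CondP5 P l` (the place over `7 ∤ 2l` is a pole of `j`); (P6) `CondP6 P l` — by the
tree's PROVED (P4) ⟹ (P6) `condP6_of_seven_le` (pp. 45–46), as `log(q^∀(P))` exceeds its threshold `H_K`; and
`H < log(q^∀(P))`. [cite: Mochizuki2012, IUTchIV Cor 2.2 (ii) proof (P1)-(P7) pp.45-46] -/
theorem exists_thm110Legendre_antecedent (H : ℝ) :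
    ∃ (η : ℝ) (P : NFPoint) (l : ℕ), IsEtaPrm η ∧ P ∈ UP ∧
      P ∈ (CBData.std {2} (by simp [Nat.prime_two])).toSet ∧ P ∈ UPle 1 ∧
      l.Prime ∧ 7 ≤ l ∧ AdmitsCore P ∧ CondP2 P l ∧ CondP5 P l ∧ CondP6 P l ∧ H < logQForall P := by
  have hS : ∀ p ∈ ({2} : Finset ℕ), p.Prime := by simp [Nat.prime_two]
  obtain ⟨η, hη⟩ := exists_isEtaPrm
  obtain ⟨HK, hHK⟩ := condP6_of_seven_le (CBData.std {2} hS)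
  obtain ⟨q, hmem, hU1, hcore, hbig, hneg⟩ := exists_ratPoint_mem_std_two hS (max H HK)
  have hUP : ratPoint q ∈ UP := UPle_subset_UP 1 hU1
  obtain ⟨l, hl, hlp⟩ := Nat.exists_infinite_primes
    (max 8 (⌈((ratPoint q).degree : ℝ) * logQForall (ratPoint q) / Real.log 2⌉₊ + 1))
  have hl8 : 8 ≤ l := (le_max_left _ _).trans hl
  have hl7 : 7 ≤ l := by omega
  have hP2 : CondP2 (ratPoint q) l := by
    apply condP2_of_lt
    have h2 := Nat.le_ceil (((ratPoint q).degree : ℝ) * logQForall (ratPoint q) / Real.log 2)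
    have h3 : ((⌈((ratPoint q).degree : ℝ) * logQForall (ratPoint q) / Real.log 2⌉₊ + 1 : ℕ) : ℝ) ≤ l := by
      exact_mod_cast (le_max_right _ _).trans hl
    push_cast at h3; linarith
  obtain ⟨v, hv⟩ := exists_place_natGenerator_eq (show Nat.Prime 7 by norm_num)
  have hP5 : CondP5 (ratPoint q) l := by
    refine ⟨v, hneg v hv, ?_, ?_⟩
    · change ¬ ((2 : ℕ) : 𝓞 ℚ) ∈ v.asIdeal
      rw [UniformABCConjecture.natCast_mem_asIdeal_iff, hv]; norm_num
    · change ¬ ((l : ℕ) : 𝓞 ℚ) ∈ v.asIdeal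
      rw [UniformABCConjecture.natCast_mem_asIdeal_iff, hv]
      intro h
      have : 7 = l := (Nat.prime_dvd_prime_iff_eq (by norm_num) hlp).1 h
      omega
  have hP6 : CondP6 (ratPoint q) l :=
    hHK (ratPoint q) hmem hUP l hlp hl7 hP2 hP5 (lt_of_le_of_lt (le_max_right _ _) hbig)
  exact ⟨η, ratPoint q, l, hη, hUP, hmem, hU1, hlp, hl7, hcore, hP2, hP5, hP6,
    lt_of_le_of_lt (le_max_left _ _) hbig⟩

/-- **`Thm110Legendre` is contentful**: it FORCES the display of [IUTchIV] Thm. 1.10 as consumed by Cor. 2.2 (ii)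
(`Cor22.Display P l η`) at `λ`-line points of `K_V = CBData.std {2}` with arbitrarily large `log(q^∀)`, for some
admissible prime `l ≥ 7`. Nothing is asserted: `Thm110Legendre` is the hypothesis.
[cite: Mochizuki2012, IUTchIV Cor 2.2 (ii) proof p.46] -/
theorem exists_display_of_thm110Legendre (h110 : Thm110Legendre) (H : ℝ) :
    ∃ (η : ℝ) (P : NFPoint) (l : ℕ), IsEtaPrm η ∧ P ∈ (CBData.std {2} (by simp [Nat.prime_two])).toSet ∧
      P ∈ UPle 1 ∧ l.Prime ∧ 7 ≤ l ∧ H < logQForall P ∧ Display P l η := by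
  obtain ⟨η, P, l, hη, hUP, hmem, hU1, hlp, hl7, hcore, hP2, hP5, hP6, hH⟩ :=
    exists_thm110Legendre_antecedent H
  exact ⟨η, P, l, hη, hmem, hU1, hlp, hl7, hH, h110 η hη P hUP l hlp (le_trans (by norm_num) hl7) hcore hP2 hP5 hP6⟩

/-- **The compactly bounded subset of record is admissible for Cor. 2.2 AND carries the witnesses**:
`K_V = CBData.std {2}` satisfies `Cor22.Hypotheses` (abc-iut-w5-d056) and contains degree-`1` points of `U_X`
with arbitrarily large `log(q^∀)` — so in `ThetaPartII` / `Corollary22` the instance `D := CBData.std {2}` has a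
non-empty large-height range. [cite: Mochizuki2012, IUTchIV Cor 2.2 pp.41-43] -/
theorem exists_hypotheses_unbounded_logQForall :
    ∃ D : CBData, Hypotheses D ∧ ∀ H : ℝ, ∃ P : NFPoint, P ∈ D.toSet ∧ P ∈ UPle 1 ∧ H < logQForall P := by
  have hS : ∀ p ∈ ({2} : Finset ℕ), p.Prime := by simp [Nat.prime_two]
  refine ⟨CBData.std {2} hS, hypotheses_std _ _ (Finset.mem_singleton_self 2), fun H => ?_⟩
  obtain ⟨q, h1, h2, -, h3, -⟩ := exists_ratPoint_mem_std_two hS H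
  exact ⟨ratPoint q, h1, h2, h3⟩

end Cor22

end Literature.IUT.LogVolume

end
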